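import Summits.NavierStokesRegularity.NavierStokesRegularity.Theorems.StrainDoorsSpacetimeRecords
import Literature.Analysis.FluidPDE.CurlIsometryCovariance
import HarnessLib

/-!
# Strain doors — THE ROTATED-DSS PERIOD IDENTITIES (strain, velocity and vorticity numbers under `c·Rᵀu(c²t, cRx) = u(t,x)`)

LEAD S-door engine plate (ns-s30-p1 g5) for nsreg-p1 g35's rounds 53/54 (records of a DSS singularity), typed on g35's
«YES» (STATUS 03:11:54Z): the rotated twins (Chae–Wolf 2017 Def. 1.1 class `IsRotatedDSS c R u`, as in the tree's
`IsTypeIDSSProfile c R u`) of the unrotated period identities `IsDiscretelySelfSimilar.strainNumber_eq` (R52),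
`dss_velocityNumber_eq` (R54) and `dss_vorticityNumber_eq` (R53).  Pure calculus, no differentiability hypotheses
(both sides take the junk value together):

* `fderiv_smul_isometry_conj` — `D(c • R⁻¹ ∘ U ∘ (c R))(x) e = c² • R⁻¹(DU(cRx)(Re))` (`fderiv_const_smul_field`,
  `LinearIsometryEquiv.comp_fderiv`, `ContinuousLinearEquiv.comp_right_fderiv`, `fderiv_comp_smul`);
* `IsRotatedDSS.strainQuad_eq` ★ — `⟪∇u(t,x)e,e⟫ = c²·⟪∇u(c²t,cRx)(Re), Re⟫`; `IsRotatedDSS.strainNumber_eq` —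
  `(0−t)·q(t,x,e) = (0−c²t)·q(c²t, cRx, Re)` (unit directions go to unit directions);
* `IsRotatedDSS.norm_eq` / `IsRotatedDSS.velocityNumber_eq` — `‖u(t,x)‖ = c‖u(c²t,cRx)‖`, `(0−t)|u|²` invariant (`c ≥ 0`);
* `IsRotatedDSS.norm_curl_eq` ★ / `IsRotatedDSS.vorticityNumber_eq` — `‖ω(t,x)‖ = c²‖ω(c²t,cRx)‖`, `(0−t)|ω|` invariant
  (the curl is a pseudo-vector: tree `norm_curl_conj_linearIsometryEquiv`, `det R = ±1`).

With these, the one-period reductions and attained-supremum theorems of R53/R54 (unrotated class) port to the rotated class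
by replacing `(c²t, cx, e)` with `(c²t, cRx, Re)`.  HONEST FRAME: identities only; nothing about blow-up or profiles is
excluded; item 0056 `NoTypeII` / 10661 / NS regularity are NOT proved.  `--supports stmt-NavierStokesRegularity-0056 --as helper`.
-/

noncomputable section

open MeasureTheory Set Function Filter InnerProductSpace Metric
open scoped RealInnerProductSpace ContDiff Topology
open Literature.Analysis Literature.Analysis.FluidPDE Literature.Analysis.FluidPDE.VorticityDirectionDynamics

set_option linter.dupNamespace false

namespace Summit.NavierStokesRegularity.NavierStokesRegularity.Theorems.StrainDoors

/-- support: the gradient of `x ↦ c • R⁻¹ (U (c • R x))` (`R` a linear isometry, no differentiability needed):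
`D(c • R⁻¹ ∘ U ∘ (c R))(x) = c² • R⁻¹ ∘ DU(cRx) ∘ R`. -/
theorem fderiv_smul_isometry_conj (c : ℝ) (R : (EuclideanSpace ℝ (Fin 3)) ≃ₗᵢ[ℝ] (EuclideanSpace ℝ (Fin 3)))
    (U : (EuclideanSpace ℝ (Fin 3)) → (EuclideanSpace ℝ (Fin 3))) (x e : EuclideanSpace ℝ (Fin 3)) :
    fderiv ℝ (fun y => c • R.symm (U (c • R y))) x e = c ^ 2 • R.symm (fderiv ℝ U (c • R x) (R e)) := by
  -- peel the outer scalar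
  have h1 : (fun y : EuclideanSpace ℝ (Fin 3) => c • R.symm (U (c • R y))) =
      c • (fun y => R.symm (U (c • R y))) := rfl
  rw [h1, fderiv_const_smul_field, Pi.smul_apply]
  -- the outer isometry
  have h2 : (fun y : EuclideanSpace ℝ (Fin 3) => R.symm (U (c • R y))) = R.symm ∘ (fun y => U (c • R y)) := rfl
  rw [h2, LinearIsometryEquiv.comp_fderiv]
  -- the inner map `y ↦ U (c • R y) = (fun z => U (c • z)) ∘ R`
  have h3 : (fun y : EuclideanSpace ℝ (Fin 3) => U (c • R y)) =
      (fun z => U (c • z)) ∘ (R.toContinuousLinearEquiv : EuclideanSpace ℝ (Fin 3) → EuclideanSpace ℝ (Fin 3)) := rfl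
  rw [h3, ContinuousLinearEquiv.comp_right_fderiv, _root_.fderiv_comp_smul]
  simp [smul_smul, sq]

/-- ★ THE ROTATED PERIOD IDENTITY.  For a rotated DSS field (`c • Rᵀ u(c²t, cRx) = u(t,x)`, Chae–Wolf 2017 Def. 1.1):
`⟪∇u(t,x)e,e⟫ = c²·⟪∇u(c²t, cRx)(Re), Re⟫`, hence the strain number density satisfies
`(0 − t)·q(t,x,e) = (0 − c²t)·q(c²t, cRx, Re)` — the rotated twin of `IsDiscretelySelfSimilar.strainNumber_eq`
(unit directions are carried to unit directions, `‖Re‖ = ‖e‖`). -/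
theorem _root_.Literature.Analysis.FluidPDE.IsRotatedDSS.strainQuad_eq {c : ℝ}
    {R : (EuclideanSpace ℝ (Fin 3)) ≃ₗᵢ[ℝ] (EuclideanSpace ℝ (Fin 3))}
    {u : ℝ → (EuclideanSpace ℝ (Fin 3)) → (EuclideanSpace ℝ (Fin 3))} (h : IsRotatedDSS c R u)
    (t : ℝ) (x e : EuclideanSpace ℝ (Fin 3)) :
    strainQuad u t x e = c ^ 2 * strainQuad u (c ^ 2 * t) (c • R x) (R e) := by
  have hfun : u t = fun y => c • R.symm (u (c ^ 2 * t) (c • R y)) := by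
    funext y; exact (h t y).symm
  unfold strainQuad
  rw [hfun, fderiv_smul_isometry_conj, real_inner_smul_left, LinearIsometryEquiv.inner_map_eq_flip,
    LinearIsometryEquiv.symm_symm]

/-- ★ … and for the strain number density: `(0 − t)·q(t,x,e) = (0 − c²t)·q(c²t, cRx, Re)`. -/
theorem _root_.Literature.Analysis.FluidPDE.IsRotatedDSS.strainNumber_eq {c : ℝ}
    {R : (EuclideanSpace ℝ (Fin 3)) ≃ₗᵢ[ℝ] (EuclideanSpace ℝ (Fin 3))}
    {u : ℝ → (EuclideanSpace ℝ (Fin 3)) → (EuclideanSpace ℝ (Fin 3))} (h : IsRotatedDSS c R u)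
    (t : ℝ) (x e : EuclideanSpace ℝ (Fin 3)) :
    (0 - t) * strainQuad u t x e = (0 - c ^ 2 * t) * strainQuad u (c ^ 2 * t) (c • R x) (R e) := by
  rw [h.strainQuad_eq t x e]; ring


/-- ★ VELOCITY under rotated DSS: `‖u(t,x)‖ = c·‖u(c²t, cRx)‖` for `c ≥ 0` (the rotation is an isometry). -/
theorem _root_.Literature.Analysis.FluidPDE.IsRotatedDSS.norm_eq {c : ℝ} (hc : 0 ≤ c)
    {R : (EuclideanSpace ℝ (Fin 3)) ≃ₗᵢ[ℝ] (EuclideanSpace ℝ (Fin 3))}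
    {u : ℝ → (EuclideanSpace ℝ (Fin 3)) → (EuclideanSpace ℝ (Fin 3))} (h : IsRotatedDSS c R u)
    (t : ℝ) (x : EuclideanSpace ℝ (Fin 3)) :
    ‖u t x‖ = c * ‖u (c ^ 2 * t) (c • R x)‖ := by
  rw [← h t x, norm_smul, LinearIsometryEquiv.norm_map, Real.norm_of_nonneg hc]

/-- ★ … hence the squared velocity number is invariant: `(0 − t)|u(t,x)|² = (0 − c²t)|u(c²t, cRx)|²`. -/
theorem _root_.Literature.Analysis.FluidPDE.IsRotatedDSS.velocityNumber_eq {c : ℝ} (hc : 0 ≤ c)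
    {R : (EuclideanSpace ℝ (Fin 3)) ≃ₗᵢ[ℝ] (EuclideanSpace ℝ (Fin 3))}
    {u : ℝ → (EuclideanSpace ℝ (Fin 3)) → (EuclideanSpace ℝ (Fin 3))} (h : IsRotatedDSS c R u)
    (t : ℝ) (x : EuclideanSpace ℝ (Fin 3)) :
    (0 - t) * ‖u t x‖ ^ 2 = (0 - c ^ 2 * t) * ‖u (c ^ 2 * t) (c • R x)‖ ^ 2 := by
  rw [h.norm_eq hc t x, mul_pow]
  ring

/-- ★ VORTICITY under rotated DSS: `‖ω(t,x)‖ = c²·‖ω(c²t, cRx)‖` (the curl is a pseudo-vector: it turns with `R` up to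
the sign `det R`, tree `norm_curl_conj_linearIsometryEquiv`; the scaling contributes `c·c`). -/
theorem _root_.Literature.Analysis.FluidPDE.IsRotatedDSS.norm_curl_eq {c : ℝ} (hc : 0 ≤ c)
    {R : (EuclideanSpace ℝ (Fin 3)) ≃ₗᵢ[ℝ] (EuclideanSpace ℝ (Fin 3))}
    {u : ℝ → (EuclideanSpace ℝ (Fin 3)) → (EuclideanSpace ℝ (Fin 3))} (h : IsRotatedDSS c R u)
    (t : ℝ) (x : EuclideanSpace ℝ (Fin 3)) :
    ‖curl (u t) x‖ = c ^ 2 * ‖curl (u (c ^ 2 * t)) (c • R x)‖ := by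
  -- `u t = c • (R⁻¹ ∘ V ∘ R)` with `V z = u(c²t)(c z)`
  set V : (EuclideanSpace ℝ (Fin 3)) → (EuclideanSpace ℝ (Fin 3)) := fun z => u (c ^ 2 * t) (c • z) with hV
  have hfun : u t = fun y => c • R.symm (V (R.symm.symm y)) := by
    funext y; rw [LinearIsometryEquiv.symm_symm]; exact (h t y).symm
  have h1 : curl (u t) x = c • curl (fun y => R.symm (V (R.symm.symm y))) x := by
    rw [hfun, curl_eq_curlCLM, curl_eq_curlCLM]
    have : (fun y => c • R.symm (V (R.symm.symm y))) = c • fun y => R.symm (V (R.symm.symm y)) := rfl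
    rw [this, fderiv_const_smul_field, Pi.smul_apply, map_smul]
  have h2 : ‖curl (fun y => R.symm (V (R.symm.symm y))) x‖ = ‖curl V (R.symm.symm x)‖ :=
    norm_curl_conj_linearIsometryEquiv R.symm V x
  have h3 : curl V (R x) = c • curl (u (c ^ 2 * t)) (c • R x) := by
    rw [curl_eq_curlCLM, curl_eq_curlCLM, hV, _root_.fderiv_comp_smul, map_smul]
  rw [h1, norm_smul, Real.norm_of_nonneg hc, h2, LinearIsometryEquiv.symm_symm, h3, norm_smul,
    Real.norm_of_nonneg hc]
  ring

/-- ★ … hence the vorticity number is invariant: `(0 − t)|ω(t,x)| = (0 − c²t)|ω(c²t, cRx)|`. -/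
theorem _root_.Literature.Analysis.FluidPDE.IsRotatedDSS.vorticityNumber_eq {c : ℝ} (hc : 0 ≤ c)
    {R : (EuclideanSpace ℝ (Fin 3)) ≃ₗᵢ[ℝ] (EuclideanSpace ℝ (Fin 3))}
    {u : ℝ → (EuclideanSpace ℝ (Fin 3)) → (EuclideanSpace ℝ (Fin 3))} (h : IsRotatedDSS c R u)
    (t : ℝ) (x : EuclideanSpace ℝ (Fin 3)) :
    (0 - t) * ‖curl (u t) x‖ = (0 - c ^ 2 * t) * ‖curl (u (c ^ 2 * t)) (c • R x)‖ := by
  rw [h.norm_curl_eq hc t x]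
  ring

end Summit.NavierStokesRegularity.NavierStokesRegularity.Theorems.StrainDoors

end
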